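import Mathlib.Data.Finset.Max
import Mathlib.Data.Finset.SymmDiff
import Mathlib.Data.Finset.Card
import Mathlib.Algebra.Group.Nat.Even
import Mathlib.Order.Interval.Finset.Nat
import HarnessLib

/-!
# Wall sets of words on a path (PATH LEMMA of hub-Kleitman: the dictionary words ↔ walls, memo §1.3)

Support file (`--supports stmt-CriticalPhenomena-4575`, closed), prover `prim-cplus-coupling` (gen 51).  No definitions, no notations,
no named facts, no sorries; standard axioms.  Memo `prim-cplus-coupling/A5-COUPLING-gen51.md` §1.3.

A colouring of the path `u = w₀, …, w_ℓ = b` is the set `ω ⊆ [1, ℓ]` of its red edges (edge `k` joins `w_{k-1}, w_k`).  Its WALL SET is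
`D(ω) = {k ∈ [1, ℓ-1] : edges k, k+1 have different colours}` (hypothesis `hD`).  This file is the dictionary of memo §1.3:
* `walls_parity` — `k ∈ ω ↔ 1 ∈ ω` iff the number of walls below `k` is even; hence the word is determined by its first colour and its
  walls (`walls_ext`), the first run is `[1, min D]` (`walls_run_left`, `walls_run_left_next`), the last run is `[max D + 1, ℓ]`
  (`walls_run_right`, `walls_run_right_prev`), the last colour is the first colour iff `#D` is even (`walls_last_iff`), constant words have
  no walls (`walls_eq_empty_iff`);
* `walls_compl` — complementation keeps the walls (and flips the first colour);
* `walls_prefix_fill` / `walls_suffix_fill` — a prefix fill `ω ∪ [1, α]` into the leading blue run TOGGLES the wall `α`, a suffix fill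
  `ω ∪ [w+1, ℓ]` into the trailing blue run toggles the wall `w` (hub moves = toggling an element `≤ min D` / `≥ max D`).
These feed the transport of the augmented staircase theorem (`…KernelMixHubClosed`) to words (`…KernelMixHubPath*`).
[cite: KozmaNitzan2024, Questions 8–9 (§5.5 p. 36) (context)]
-/

namespace Summit.CriticalPhenomena.PercolationContinuityZ3.Theorems

open Finset
open scoped symmDiff

namespace Coefficientwise

/-- Membership in the wall set. [folklore] -/
theorem walls_mem_iff (ℓ : ℕ) (D : Finset ℕ → Finset ℕ)
    (hD : ∀ ω, D ω = (Icc 1 (ℓ - 1)).filter (fun k => ¬ (k ∈ ω ↔ k + 1 ∈ ω))) (ω : Finset ℕ) (k : ℕ) :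
    k ∈ D ω ↔ 1 ≤ k ∧ k ≤ ℓ - 1 ∧ ¬ (k ∈ ω ↔ k + 1 ∈ ω) := by
  rw [hD, Finset.mem_filter, Finset.mem_Icc, and_assoc]

/-- Walls lie in `[1, ℓ-1]`. [folklore] -/
theorem walls_bounds (ℓ : ℕ) (D : Finset ℕ → Finset ℕ)
    (hD : ∀ ω, D ω = (Icc 1 (ℓ - 1)).filter (fun k => ¬ (k ∈ ω ↔ k + 1 ∈ ω))) (ω : Finset ℕ) (k : ℕ) (hk : k ∈ D ω) :
    1 ≤ k ∧ k ≤ ℓ - 1 := by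
  have h := (walls_mem_iff ℓ D hD ω k).mp hk
  exact ⟨h.1, h.2.1⟩

/-- **Parity lemma.**  For `1 ≤ k ≤ ℓ`: edge `k` has the colour of edge `1` iff the number of walls `< k` is even. [folklore] -/
theorem walls_parity (ℓ : ℕ) (D : Finset ℕ → Finset ℕ)
    (hD : ∀ ω, D ω = (Icc 1 (ℓ - 1)).filter (fun k => ¬ (k ∈ ω ↔ k + 1 ∈ ω))) (ω : Finset ℕ) :
    ∀ k, 1 ≤ k → k ≤ ℓ → ((k ∈ ω ↔ 1 ∈ ω) ↔ Even ((D ω).filter (fun x => x < k)).card) := by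
  intro k hk1
  induction k, hk1 using Nat.le_induction with
  | base =>
    intro _
    have h0 : (D ω).filter (fun x => x < 1) = ∅ := by
      ext x
      simp only [Finset.mem_filter, Finset.notMem_empty, iff_false, not_and, not_lt]
      intro hx
      exact (walls_bounds ℓ D hD ω x hx).1
    rw [h0, Finset.card_empty]
    simp
  | succ k hk ih =>
    intro hk1
    have ih' := ih (by omega)
    by_cases hkD : k ∈ D ω
    · have hsplit : (D ω).filter (fun x => x < k + 1) = insert k ((D ω).filter (fun x => x < k)) := by
        ext x
        simp only [Finset.mem_filter, Finset.mem_insert]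
        constructor
        · rintro ⟨hx, hlt⟩
          by_cases hxk : x = k
          · exact Or.inl hxk
          · exact Or.inr ⟨hx, by omega⟩
        · rintro (rfl | ⟨hx, hlt⟩)
          · exact ⟨hkD, by omega⟩
          · exact ⟨hx, by omega⟩
      have hnot : k ∉ (D ω).filter (fun x => x < k) := by simp
      rw [hsplit, Finset.card_insert_of_notMem hnot, Nat.even_add_one, ← ih']
      have hw := ((walls_mem_iff ℓ D hD ω k).mp hkD).2.2
      tauto
    · have hsame : (D ω).filter (fun x => x < k + 1) = (D ω).filter (fun x => x < k) := by
        ext x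
        simp only [Finset.mem_filter]
        constructor
        · rintro ⟨hx, hlt⟩
          have hxk : x ≠ k := fun h => hkD (h ▸ hx)
          exact ⟨hx, by omega⟩
        · rintro ⟨hx, hlt⟩
          exact ⟨hx, by omega⟩
      rw [hsame, ← ih']
      have hw : (k ∈ ω ↔ k + 1 ∈ ω) := by
        by_contra h
        exact hkD ((walls_mem_iff ℓ D hD ω k).mpr ⟨by omega, by omega, h⟩)
      tauto

/-- A word is determined by its first colour and its walls. [folklore] -/
theorem walls_ext (ℓ : ℕ) (D : Finset ℕ → Finset ℕ)
    (hD : ∀ ω, D ω = (Icc 1 (ℓ - 1)).filter (fun k => ¬ (k ∈ ω ↔ k + 1 ∈ ω))) (ω₁ ω₂ : Finset ℕ)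
    (h₁ : ω₁ ⊆ Icc 1 ℓ) (h₂ : ω₂ ⊆ Icc 1 ℓ) (hfirst : (1 ∈ ω₁ ↔ 1 ∈ ω₂)) (hwalls : D ω₁ = D ω₂) : ω₁ = ω₂ := by
  ext k
  by_cases hk : 1 ≤ k ∧ k ≤ ℓ
  · have p₁ := walls_parity ℓ D hD ω₁ k hk.1 hk.2
    have p₂ := walls_parity ℓ D hD ω₂ k hk.1 hk.2
    rw [hwalls] at p₁
    tauto
  · constructor
    · intro h; have := Finset.mem_Icc.mp (h₁ h); exact absurd this hk
    · intro h; have := Finset.mem_Icc.mp (h₂ h); exact absurd this hk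

/-- The first run: every edge `k ≤ min D` has the colour of edge `1`. [folklore] -/
theorem walls_run_left (ℓ : ℕ) (D : Finset ℕ → Finset ℕ)
    (hD : ∀ ω, D ω = (Icc 1 (ℓ - 1)).filter (fun k => ¬ (k ∈ ω ↔ k + 1 ∈ ω))) (ω : Finset ℕ)
    (h : (D ω).Nonempty) (k : ℕ) (hk1 : 1 ≤ k) (hk : k ≤ (D ω).min' h) : (k ∈ ω ↔ 1 ∈ ω) := by
  have hm := walls_bounds ℓ D hD ω _ ((D ω).min'_mem h)
  have h0 : (D ω).filter (fun x => x < k) = ∅ := by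
    ext x
    simp only [Finset.mem_filter, Finset.notMem_empty, iff_false, not_and, not_lt]
    intro hx
    exact le_trans hk ((D ω).min'_le x hx)
  have p := walls_parity ℓ D hD ω k hk1 (by omega)
  rw [h0, Finset.card_empty] at p
  simpa using p

/-- The first wall: edge `min D + 1` has the opposite colour of edge `1`. [folklore] -/
theorem walls_run_left_next (ℓ : ℕ) (D : Finset ℕ → Finset ℕ)
    (hD : ∀ ω, D ω = (Icc 1 (ℓ - 1)).filter (fun k => ¬ (k ∈ ω ↔ k + 1 ∈ ω))) (ω : Finset ℕ)
    (h : (D ω).Nonempty) : ((D ω).min' h + 1 ∈ ω ↔ 1 ∉ ω) := by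
  have hmD := (D ω).min'_mem h
  have hm := (walls_mem_iff ℓ D hD ω _).mp hmD
  have hfirst := walls_run_left ℓ D hD ω h ((D ω).min' h) hm.1 (le_refl _)
  tauto

/-- No walls iff the word is constant. [folklore] -/
theorem walls_eq_empty_iff (ℓ : ℕ) (D : Finset ℕ → Finset ℕ)
    (hD : ∀ ω, D ω = (Icc 1 (ℓ - 1)).filter (fun k => ¬ (k ∈ ω ↔ k + 1 ∈ ω))) (ω : Finset ℕ) :
    D ω = ∅ ↔ ∀ k, 1 ≤ k → k ≤ ℓ → (k ∈ ω ↔ 1 ∈ ω) := by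
  constructor
  · intro h0 k hk1 hk
    have p := walls_parity ℓ D hD ω k hk1 hk
    rw [h0, Finset.filter_empty, Finset.card_empty] at p
    simpa using p
  · intro hconst
    rw [Finset.eq_empty_iff_forall_notMem]
    intro k hk
    have hb := (walls_mem_iff ℓ D hD ω k).mp hk
    have h1 := hconst k hb.1 (by omega)
    have h2 := hconst (k + 1) (by omega) (by omega)
    exact hb.2.2 (h1.trans h2.symm)

/-- Last colour = first colour iff the number of walls is even (for `ℓ ≥ 1`). [folklore] -/
theorem walls_last_iff (ℓ : ℕ) (hℓ : 1 ≤ ℓ) (D : Finset ℕ → Finset ℕ)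
    (hD : ∀ ω, D ω = (Icc 1 (ℓ - 1)).filter (fun k => ¬ (k ∈ ω ↔ k + 1 ∈ ω))) (ω : Finset ℕ) :
    ((ℓ ∈ ω ↔ 1 ∈ ω) ↔ Even (D ω).card) := by
  have p := walls_parity ℓ D hD ω ℓ hℓ (le_refl _)
  have hall : (D ω).filter (fun x => x < ℓ) = D ω := by
    ext x
    simp only [Finset.mem_filter, and_iff_left_iff_imp]
    intro hx
    have := walls_bounds ℓ D hD ω x hx
    omega
  rw [hall] at p
  exact p

/-- The last run: every edge `k > max D` has the colour of edge `ℓ`. [folklore] -/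
theorem walls_run_right (ℓ : ℕ) (D : Finset ℕ → Finset ℕ)
    (hD : ∀ ω, D ω = (Icc 1 (ℓ - 1)).filter (fun k => ¬ (k ∈ ω ↔ k + 1 ∈ ω))) (ω : Finset ℕ)
    (h : (D ω).Nonempty) (k : ℕ) (hk : (D ω).max' h + 1 ≤ k) (hkℓ : k ≤ ℓ) : (k ∈ ω ↔ ℓ ∈ ω) := by
  have hM := walls_bounds ℓ D hD ω _ ((D ω).max'_mem h)
  have hall : ∀ k', (D ω).max' h + 1 ≤ k' → (D ω).filter (fun x => x < k') = D ω := by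
    intro k' hk'
    ext x
    simp only [Finset.mem_filter, and_iff_left_iff_imp]
    intro hx
    exact Nat.lt_of_le_of_lt ((D ω).le_max' x hx) (by omega)
  have p := walls_parity ℓ D hD ω k (by omega) hkℓ
  have pℓ := walls_parity ℓ D hD ω ℓ (by omega) (le_refl _)
  rw [hall k hk] at p
  rw [hall ℓ (by omega)] at pℓ
  tauto

/-- The last wall: edge `max D` has the opposite colour of edge `ℓ`. [folklore] -/
theorem walls_run_right_prev (ℓ : ℕ) (D : Finset ℕ → Finset ℕ)
    (hD : ∀ ω, D ω = (Icc 1 (ℓ - 1)).filter (fun k => ¬ (k ∈ ω ↔ k + 1 ∈ ω))) (ω : Finset ℕ)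
    (h : (D ω).Nonempty) : ((D ω).max' h ∈ ω ↔ ℓ ∉ ω) := by
  have hMD := (D ω).max'_mem h
  have hM := (walls_mem_iff ℓ D hD ω _).mp hMD
  have hnext := walls_run_right ℓ D hD ω h ((D ω).max' h + 1) (le_refl _) (by omega)
  tauto

/-- Complementation keeps the walls. [folklore] -/
theorem walls_compl (ℓ : ℕ) (hℓ : 1 ≤ ℓ) (D : Finset ℕ → Finset ℕ)
    (hD : ∀ ω, D ω = (Icc 1 (ℓ - 1)).filter (fun k => ¬ (k ∈ ω ↔ k + 1 ∈ ω))) (ω : Finset ℕ) :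
    D (Icc 1 ℓ \ ω) = D ω := by
  ext k
  rw [walls_mem_iff ℓ D hD, walls_mem_iff ℓ D hD]
  simp only [Finset.mem_sdiff, Finset.mem_Icc]
  constructor
  · rintro ⟨h1, h2, h3⟩
    refine ⟨h1, h2, fun h => h3 ?_⟩
    constructor
    · rintro ⟨_, hk⟩; exact ⟨⟨by omega, by omega⟩, fun h' => hk (h.mpr h')⟩
    · rintro ⟨_, hk⟩; exact ⟨⟨by omega, by omega⟩, fun h' => hk (h.mp h')⟩
  · rintro ⟨h1, h2, h3⟩
    refine ⟨h1, h2, fun h => h3 ?_⟩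
    constructor
    · intro hk
      by_contra hk1
      exact (h.mpr ⟨⟨by omega, by omega⟩, hk1⟩).2 hk
    · intro hk1
      by_contra hk
      exact (h.mp ⟨⟨by omega, by omega⟩, hk⟩).2 hk1

/-- **Prefix fill = toggle.**  Filling `[1, α]` (inside the leading blue run, `1 ≤ α ≤ ℓ-1`) toggles the wall `α`. [folklore] -/
theorem walls_prefix_fill (ℓ : ℕ) (D : Finset ℕ → Finset ℕ)
    (hD : ∀ ω, D ω = (Icc 1 (ℓ - 1)).filter (fun k => ¬ (k ∈ ω ↔ k + 1 ∈ ω))) (ω : Finset ℕ)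
    (α : ℕ) (hα1 : 1 ≤ α) (hα : α ≤ ℓ - 1) (hblue : ∀ k ∈ ω, α < k) :
    D (ω ∪ Icc 1 α) = D ω ∆ {α} := by
  ext k
  rw [walls_mem_iff ℓ D hD, Finset.mem_symmDiff, walls_mem_iff ℓ D hD, Finset.mem_singleton]
  simp only [Finset.mem_union, Finset.mem_Icc]
  have hαn : α ∉ ω := fun h => absurd (hblue α h) (lt_irrefl α)
  rcases Nat.lt_trichotomy k α with hlt | rfl | hgt
  · -- k < α: no wall on either side
    have hk0 : k ∉ ω := fun h => absurd (hblue k h) (by omega)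
    have hk1 : k + 1 ∉ ω := fun h => absurd (hblue (k + 1) h) (by omega)
    constructor
    · rintro ⟨h1, _, h3⟩
      exfalso; apply h3
      constructor
      · intro; exact Or.inr ⟨by omega, by omega⟩
      · intro; exact Or.inr ⟨h1, by omega⟩
    · rintro (⟨⟨_, _, h3⟩, _⟩ | ⟨h, _⟩)
      · exfalso; exact h3 ⟨fun h => absurd h hk0, fun h => absurd h hk1⟩
      · omega
  · -- k = α: the wall is toggled
    constructor
    · rintro ⟨h1, h2, h3⟩
      by_cases hw : 1 ≤ k ∧ k ≤ ℓ - 1 ∧ ¬ (k ∈ ω ↔ k + 1 ∈ ω)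
      · exfalso
        apply h3
        constructor
        · intro _
          have : k + 1 ∈ ω := by
            by_contra hc; exact hw.2.2 ⟨fun h => absurd h hαn, fun h => absurd h hc⟩
          exact Or.inl this
        · intro _; exact Or.inr ⟨h1, le_refl _⟩
      · exact Or.inr ⟨rfl, hw⟩
    · rintro (⟨⟨h1, h2, h3⟩, hne⟩ | ⟨_, hw⟩)
      · exact absurd rfl hne
      · refine ⟨hα1, hα, fun h => hw ⟨hα1, hα, ?_⟩⟩
        have hk1 : k + 1 ∈ ω ∨ 1 ≤ k + 1 ∧ k + 1 ≤ k := h.mp (Or.inr ⟨hα1, le_refl _⟩)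
        have hk1' : k + 1 ∈ ω := by rcases hk1 with h' | h'; exact h'; omega
        exact fun hiff => hαn (hiff.mpr hk1')
  · -- k > α: unchanged
    constructor
    · rintro ⟨h1, h2, h3⟩
      refine Or.inl ⟨⟨h1, h2, fun h => h3 ?_⟩, by omega⟩
      constructor
      · rintro (hk | hk); · exact Or.inl (h.mp hk)
        · omega
      · rintro (hk | hk); · exact Or.inl (h.mpr hk)
        · omega
    · rintro (⟨⟨h1, h2, h3⟩, _⟩ | ⟨h, _⟩)
      · refine ⟨h1, h2, fun h => h3 ?_⟩
        constructor
        · intro hk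
          rcases h.mp (Or.inl hk) with h' | h'; · exact h'
          · omega
        · intro hk
          rcases h.mpr (Or.inl hk) with h' | h'; · exact h'
          · omega
      · omega

/-- **Suffix fill = toggle.**  Filling `[w+1, ℓ]` (inside the trailing blue run, `1 ≤ w ≤ ℓ-1`) toggles the wall `w`. [folklore] -/
theorem walls_suffix_fill (ℓ : ℕ) (D : Finset ℕ → Finset ℕ)
    (hD : ∀ ω, D ω = (Icc 1 (ℓ - 1)).filter (fun k => ¬ (k ∈ ω ↔ k + 1 ∈ ω))) (ω : Finset ℕ)
    (w : ℕ) (hw1 : 1 ≤ w) (hw : w ≤ ℓ - 1) (hblue : ∀ k ∈ ω, k ≤ w) :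
    D (ω ∪ Icc (w + 1) ℓ) = D ω ∆ {w} := by
  ext k
  rw [walls_mem_iff ℓ D hD, Finset.mem_symmDiff, walls_mem_iff ℓ D hD, Finset.mem_singleton]
  simp only [Finset.mem_union, Finset.mem_Icc]
  have hwn : w + 1 ∉ ω := fun h => absurd (hblue _ h) (by omega)
  rcases Nat.lt_trichotomy k w with hlt | rfl | hgt
  · -- k < w: unchanged
    constructor
    · rintro ⟨h1, h2, h3⟩
      refine Or.inl ⟨⟨h1, h2, fun h => h3 ?_⟩, by omega⟩
      constructor
      · rintro (hk | hk); · exact Or.inl (h.mp hk)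
        · omega
      · rintro (hk | hk); · exact Or.inl (h.mpr hk)
        · omega
    · rintro (⟨⟨h1, h2, h3⟩, _⟩ | ⟨h, _⟩)
      · refine ⟨h1, h2, fun h => h3 ?_⟩
        constructor
        · intro hk
          rcases h.mp (Or.inl hk) with h' | h'; · exact h'
          · omega
        · intro hk
          rcases h.mpr (Or.inl hk) with h' | h'; · exact h'
          · omega
      · omega
  · -- k = w: toggled
    constructor
    · rintro ⟨h1, h2, h3⟩
      by_cases hwD : 1 ≤ k ∧ k ≤ ℓ - 1 ∧ ¬ (k ∈ ω ↔ k + 1 ∈ ω)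
      · exfalso
        apply h3
        have hk : k ∈ ω := by
          by_contra hc; exact hwD.2.2 ⟨fun h => absurd h hc, fun h => absurd h hwn⟩
        constructor
        · intro _; exact Or.inr ⟨le_refl _, by omega⟩
        · intro _; exact Or.inl hk
      · exact Or.inr ⟨rfl, hwD⟩
    · rintro (⟨_, hne⟩ | ⟨_, hwD⟩)
      · exact absurd rfl hne
      · refine ⟨hw1, hw, fun h => hwD ⟨hw1, hw, ?_⟩⟩
        have hk : k ∈ ω ∨ k + 1 ≤ k ∧ k ≤ ℓ := h.mpr (Or.inr ⟨le_refl _, by omega⟩)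
        have hk' : k ∈ ω := by rcases hk with h' | h'; exact h'; omega
        exact fun hiff => hwn (hiff.mp hk')
  · -- k > w: no wall on either side
    have hk0 : k ∉ ω := fun h => absurd (hblue k h) (by omega)
    have hk1 : k + 1 ∉ ω := fun h => absurd (hblue (k + 1) h) (by omega)
    constructor
    · rintro ⟨h1, h2, h3⟩
      exfalso; apply h3
      constructor
      · intro; exact Or.inr ⟨by omega, by omega⟩
      · intro; exact Or.inr ⟨by omega, by omega⟩
    · rintro (⟨⟨_, _, h3⟩, _⟩ | ⟨h, _⟩)
      · exfalso; exact h3 ⟨fun h => absurd h hk0, fun h => absurd h hk1⟩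
      · omega

end Coefficientwise

end Summit.CriticalPhenomena.PercolationContinuityZ3.Theorems
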